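import Summits.BirchSwinnertonDyer.BirchSwinnertonDyer.Theorems.ManinLocalTwoThreeGenerationCocycleHecke
import Summits.BirchSwinnertonDyer.BirchSwinnertonDyer.Theorems.PrintX11aMultAtkinLehnerPeriods
import Summits.BirchSwinnertonDyer.Rank1Residual.ManinAdditive.RelativeIharaShiftVanishingEdges
import Literature.NumberTheory.EllipticCurves.HidaOrdinaryCohomologyParabolic
import Literature.NumberTheory.EllipticCurves.ModularSymbolsParabolicCohomology
import Literature.NumberTheory.EllipticCurves.PeriodLatticeGamma1QuotientProofs
import HarnessLib
import Summits.BirchSwinnertonDyer.BirchSwinnertonDyer.Theorems.ManinLocalTwoThreeDiamondEisenstein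
import Summits.BirchSwinnertonDyer.BirchSwinnertonDyer.Theorems.ManinLocalTwoThreeParabolicElements
import Summits.BirchSwinnertonDyer.BirchSwinnertonDyer.Theorems.ManinLocalTwoThreeTameUnitTwist

/-!
# THEOREM 54 (imc g42) — part 1/4 (§1–§3): the STAR and ATKIN–LEHNER TRANSPORT on weight-2 cocycles, the EISENSTEIN SECTOR
# `IsShimuraEisenstein` with the typed candidate `SectorMultiplicityOne` (CONJECTURE M1), and the FUNCTIONAL COCYCLE `u_ψ` of a newform
# (cell bsd-f2-manin, LENS imc, route `ManinLocalTwoThree`, crux C3 `ManinPrimeToThreeAtNine` stmt-BirchSwinnertonDyer-22968 / C2 `ManinOddAtFour` stmt-22967)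

VOCABULARY (all tree): weight-2 cocycles `u : Γ₀(N) → Fin 1 → F` (`HidaCohomology.cocycles 0 N F`), the parabolic ones
`HidaCohomology.parSp N F` (additive, zero on parabolic elements), the Hecke operators `HidaCohomology.heckeU 0 N F hp`
(Shimura (8.3.2): `T_p` for `p ∤ N`, `U_p` for `p ∣ N`), the Shimura cocycle `E_χ = diamondFun N N F χ : γ ↦ χ(d_γ mod N)`,
the functional cocycle `u_ψ : γ ↦ ψ({∞, γ∞}_f)` of an additive `ψ : Λ_f → F` (`heckeU_functionalCocycle`: `T_p u_ψ = a_p(W) u_ψ`),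
`Λ₀(f) = periodLattice f`, `Λ₁(f) = periodLatticeGamma1 f`.
NEW HERE (definitions are cheap bookkeeping, no new mathematics): the STAR `u ↦ u ∘ (γ ↦ JγJ)`, `J = diag(−1,1)`
(`starConj`, `starOp`), the ATKIN–LEHNER transport `u ↦ u ∘ (γ ↦ w_Q γ w_Q⁻¹)` (`alConj`, `alOp`; `w_Q` normalises `Γ₀(N)`,
tree `atkinLehnerW_mul_mul_inv_mem`), the EISENSTEIN SECTOR `IsShimuraEisenstein N F S 𝒬 ε u` («`u` parabolic, `T_p u = (1+p)u`
(`p ∈ S`, `p ∤ N`), `U_p u = p u` (`p ∈ S`, `p ∣ N`), `W_Q u = ε_Q u` (`Q ∈ 𝒬`, `Q ∥ N`), `u` star-even»), and the typed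
candidate `SectorMultiplicityOne N F S 𝒬 ε χ` («if `E_χ` lies in the sector, the sector is the line `F·E_χ`») = CONJECTURE M1
of NOTE-53B (BC5 witness TABLE-53B: m = 1 at its 18 tame levels, two-engine certified; FALSE at 558/585/630/774/…, see §7; wild `N = 405`: m = 2).

HONEST FRAMING.  Kernel theorems are unconditional MODULO their typed hypotheses (`SectorMultiplicityOne …` = CONJECTURE M1 per
tuple, open; the `@[conjecture]` rank laws are typed census candidates, NOT theorems).  Nothing about C2/C3, Manin's conjecture or
BSD is proved here.  Source: imc g42/g43 planner sketch `HOME/imc/g43/Sketch59full.lean` 8602093605f9eb5d (MEMO-imc §53.10, §54, §55),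
landed verbatim by LEAD p1 g26 in four parts: 1 `…ShimuraSectorCocycles` (§1–§3), 2 `…ShimuraSectorCapture` (§4 THEOREM 54, §6.1–6.2),
3 `…ShimuraSectorTame` (§6.3–§7), 4 `…ShimuraSectorRankLaw` (§8–§9).
[cite: Mazur1977, II.9 and II.16 (Eisenstein ideal, multiplicity one at prime level)] [cite: Manin1972, Prop. 1.4 / Thm. 1.6]
[cite: Knapp1993, Prop. 11.1, Lemma 9.24] [cite: Shimura1971, §8.1 (8.1.4), §8.3 (8.3.2)] [cite: Stevens1989, §2]
-/

set_option autoImplicit false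
set_option linter.dupNamespace false

noncomputable section

open scoped Classical ComplexConjugate MatrixGroups ModularForm BigOperators

open CongruenceSubgroup Matrix.SpecialLinearGroup Complex
open Literature.NumberTheory.EllipticCurves Literature.NumberTheory.EllipticCurves.ModularForms
open Literature.NumberTheory.EllipticCurves.ModularForms.HidaCohomology
open Summit.BirchSwinnertonDyer.Rank1Residual.ManinAdditive (diamondFun diamondFun_apply)

namespace Summit.BirchSwinnertonDyer.BirchSwinnertonDyer.Theorems.ManinLocalTwoThree.ShimuraSector

/-! ## §1 The star and the Atkin–Lehner transport on weight-2 cocycles -/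

section Operators

variable {N : ℕ}

/-- `γ ↦ J γ J`, `J = diag(−1, 1)`: `(a, b; c, d) ↦ (a, −b; −c, d)`, an automorphism of `Γ₀(N)` (the complex conjugation of
`X₀(N)(ℂ)` on `π₁`). [cite: CremonaAlgorithms1997, §2.1.3] -/
def starConj (γ : Gamma0 N) : Gamma0 N :=
  ⟨⟨!![(γ : SL(2, ℤ)) 0 0, -((γ : SL(2, ℤ)) 0 1); -((γ : SL(2, ℤ)) 1 0), (γ : SL(2, ℤ)) 1 1], by
      have hdet := Matrix.det_fin_two (γ : SL(2, ℤ)).1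
      rw [(γ : SL(2, ℤ)).2] at hdet
      rw [Matrix.det_fin_two_of]; linear_combination -hdet⟩, by
    rw [Gamma0_mem]
    have hγ := Gamma0_mem.mp γ.2
    simp only [Matrix.of_apply, Matrix.cons_val', Matrix.cons_val_zero, Matrix.cons_val_one, Int.cast_neg, hγ, neg_zero]⟩

/-- The `(0,0)` entry of `JγJ` is `a_γ`. [folklore] -/
@[simp] theorem starConj_apply_zero_zero (γ : Gamma0 N) : ((starConj γ : Gamma0 N) : SL(2, ℤ)) 0 0 = (γ : SL(2, ℤ)) 0 0 := rfl
/-- The `(0,1)` entry of `JγJ` is `−b_γ`. [folklore] -/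
@[simp] theorem starConj_apply_zero_one (γ : Gamma0 N) : ((starConj γ : Gamma0 N) : SL(2, ℤ)) 0 1 = -((γ : SL(2, ℤ)) 0 1) := rfl
/-- The `(1,0)` entry of `JγJ` is `−c_γ`. [folklore] -/
@[simp] theorem starConj_apply_one_zero (γ : Gamma0 N) : ((starConj γ : Gamma0 N) : SL(2, ℤ)) 1 0 = -((γ : SL(2, ℤ)) 1 0) := rfl
/-- The `(1,1)` entry of `JγJ` is `d_γ`. [folklore] -/
@[simp] theorem starConj_apply_one_one (γ : Gamma0 N) : ((starConj γ : Gamma0 N) : SL(2, ℤ)) 1 1 = (γ : SL(2, ℤ)) 1 1 := rfl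

/-- The STAR on cochains: `(u⋆)(γ) = u(JγJ)`. [cite: CremonaAlgorithms1997, §2.1.3] -/
def starOp (F : Type*) (u : Gamma0 N → Fin 1 → F) : Gamma0 N → Fin 1 → F := fun γ i => u (starConj γ) i

/-- Unfolding of the star on cochains. [folklore] -/
@[simp] theorem starOp_apply (F : Type*) (u : Gamma0 N → Fin 1 → F) (γ : Gamma0 N) (i : Fin 1) :
    starOp F u γ i = u (starConj γ) i := rfl

/-- `w_Q` normalises `Γ₀(N)` (`Q ∥ N`): every `γ` has a conjugate `γ'` with `γ' · w_Q = w_Q · γ` in `GL₂(ℝ)`.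
[cite: AtkinLehner1970, Lemma 8] [cite: Knapp1993, Lemma 9.24] -/
theorem exists_alConj (Q : ℕ) [NeZero Q] (hQN : Q ∣ N) (hc : Nat.Coprime Q (N / Q)) (γ : Gamma0 N) :
    ∃ γ' : Gamma0 N, mapGL ℝ (γ' : SL(2, ℤ)) * glCast (atkinLehnerW N Q : GL (Fin 2) ℚ) =
      glCast (atkinLehnerW N Q : GL (Fin 2) ℚ) * mapGL ℝ (γ : SL(2, ℤ)) := by
  have hx : (mapGL ℝ (γ : SL(2, ℤ)) : GL (Fin 2) ℝ) ∈ (Gamma0 N : Subgroup (GL (Fin 2) ℝ)) :=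
    Subgroup.mem_map.mpr ⟨γ, γ.2, rfl⟩
  obtain ⟨γ', hγ', h⟩ := Subgroup.mem_map.mp (atkinLehnerW_mul_mul_inv_mem N Q hQN hc hx)
  refine ⟨⟨γ', hγ'⟩, ?_⟩
  show mapGL ℝ γ' * _ = _
  rw [h, inv_mul_cancel_right]

/-- The ATKIN–LEHNER CONJUGATE `γ ↦ w_Q γ w_Q⁻¹` on `Γ₀(N)` (a choice of the element of `exists_alConj`; unique since
`Γ₀(N) → GL₂(ℝ)` is injective). [cite: AtkinLehner1970, Lemma 8] -/
def alConj (Q : ℕ) [NeZero Q] (hQN : Q ∣ N) (hc : Nat.Coprime Q (N / Q)) (γ : Gamma0 N) : Gamma0 N :=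
  Classical.choose (exists_alConj Q hQN hc γ)

/-- The defining relation of the Atkin–Lehner conjugate: `γ' w_Q = w_Q γ`. [cite: AtkinLehner1970, Lemma 10] -/
theorem alConj_spec (Q : ℕ) [NeZero Q] (hQN : Q ∣ N) (hc : Nat.Coprime Q (N / Q)) (γ : Gamma0 N) :
    mapGL ℝ ((alConj Q hQN hc γ : Gamma0 N) : SL(2, ℤ)) * glCast (atkinLehnerW N Q : GL (Fin 2) ℚ) =
      glCast (atkinLehnerW N Q : GL (Fin 2) ℚ) * mapGL ℝ (γ : SL(2, ℤ)) :=
  Classical.choose_spec (exists_alConj Q hQN hc γ)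

/-- The ATKIN–LEHNER TRANSPORT on cochains: `(W_Q u)(γ) = u(w_Q γ w_Q⁻¹)`. [cite: AtkinLehner1970, Lemma 10] -/
def alOp (F : Type*) (Q : ℕ) [NeZero Q] (hQN : Q ∣ N) (hc : Nat.Coprime Q (N / Q)) (u : Gamma0 N → Fin 1 → F) :
    Gamma0 N → Fin 1 → F := fun γ i => u (alConj Q hQN hc γ) i

/-- Unfolding of the Atkin–Lehner transport on cochains. [folklore] -/
@[simp] theorem alOp_apply (F : Type*) (Q : ℕ) [NeZero Q] (hQN : Q ∣ N) (hc : Nat.Coprime Q (N / Q))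
    (u : Gamma0 N → Fin 1 → F) (γ : Gamma0 N) (i : Fin 1) : alOp F Q hQN hc u γ i = u (alConj Q hQN hc γ) i := rfl

end Operators

/-! ## §2 The Eisenstein sector and the typed candidate `SectorMultiplicityOne` (CONJECTURE M1) -/

section Sector

variable (N : ℕ) [NeZero N] (F : Type*) [Field F]

/-- **The EISENSTEIN (SHIMURA) SECTOR with signs `ε`**: `u : Γ₀(N) → 𝔽` additive and zero on parabolic elements
(`parSp`), `T_p u = (1 + p) u` for the primes `p ∈ S` not dividing `N`, `U_p u = p u` for the primes `p ∈ S` dividing `N`,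
`W_Q u = ε_Q u` for the exact divisors `Q ∈ 𝒬`, and `u` star-even.  [cite: Mazur1977, II.9 (the Eisenstein ideal
`(T_p − 1 − p, w − 1)` at prime level)] -/
def IsShimuraEisenstein (S 𝒬 : Finset ℕ) (ε : ℕ → F) (u : Gamma0 N → Fin 1 → F) : Prop :=
  u ∈ parSp N F ∧
  (∀ (p : ℕ) [NeZero p] (hp : p.Prime), p ∈ S → ¬ p ∣ N → heckeU 0 N F hp u = ((p : F) + 1) • u) ∧
  (∀ (p : ℕ) [NeZero p] (hp : p.Prime), p ∈ S → p ∣ N → heckeU 0 N F hp u = (p : F) • u) ∧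
  (∀ (Q : ℕ) [NeZero Q] (hQN : Q ∣ N) (hc : Nat.Coprime Q (N / Q)), Q ∈ 𝒬 → alOp F Q hQN hc u = ε Q • u) ∧
  starOp F u = u

/-- **TYPED CANDIDATE (CONJECTURE M1, «Eisenstein multiplicity one in the Shimura sector»)** at `(N, F, S, 𝒬, ε, χ)`:
if the Shimura cocycle `E_χ = diamondFun N N F χ` lies in the Eisenstein sector of signs `ε`, then that sector is the line
`F · E_χ`.  Census (BC5 witness, TABLE-53B, `F = 𝔽_ℓ`, `χ` TAME = conductor prime to `ℓ`, `S` = the primes `≤ 5`–`23` used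
there, `𝒬` = all prime-power exact divisors): multiplicity `1` at the 18 TABLE-53B levels (two-engine certified, ref1 §R311)
and at 67/77 tame tuples `N ≤ 2000`; it is FALSE at the ten tame tuples 558, 585, 630, 774, 1170, 1386, 1710, 1827, 1881, 1962
(`m = 2`, ref1 kit j342887 / j342908 — hence a HYPOTHESIS per tuple, governed by LAW 54.M′ `SectorRankLawWWE` of §7); it FAILS for the
wild character at `N = 405` (m = 2) and it fails WITHOUT the star or WITHOUT `W_{ℓ²}` (second line at `N = 171, 333`).
Multiplicity one at `ℓ² ∣ N` (where `J₀(N)` is not semistable at `ℓ`) is outside the printed range (Mazur 1977: prime level;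
Yoo, Wake–Wang-Erickson: squarefree level).  Tagged `@[conjecture]` (an obligation schema: provable / refutable per
parameter tuple; the census tuples are listed in TABLE-53B/54). [cite: Mazur1977, II.16–II.18] -/
@[conjecture]
def SectorMultiplicityOne (S 𝒬 : Finset ℕ) (ε : ℕ → F) (χ : ZMod N → F) : Prop :=
  IsShimuraEisenstein N F S 𝒬 ε (diamondFun N N F χ) →
    ∀ u : Gamma0 N → Fin 1 → F, IsShimuraEisenstein N F S 𝒬 ε u → ∃ c : F, u = c • diamondFun N N F χ

end Sector

/-! ## §3 The functional cocycle `u_ψ` of a newform lies in the sector -/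

section Functional

variable {N : ℕ} {f : CuspForm (Gamma0 N) 2} {F : Type*} [Field F] (ψ : ↥(periodLattice f) →+ F)

/-- The functional cocycle `u_ψ(γ) = ψ({∞, γ∞}_f)`. [cite: Manin1972, Prop. 1.4] -/
def uψ (f : CuspForm (Gamma0 N) 2) (ψ : ↥(periodLattice f) →+ F) : Gamma0 N → Fin 1 → F :=
  fun γ _ => ψ ⟨cuspSymbol f γ, cuspSymbol_mem_periodLattice f γ⟩

/-- Unfolding of the functional cocycle. [folklore] -/
@[simp] theorem uψ_apply (γ : Gamma0 N) (i : Fin 1) : uψ f ψ γ i = ψ ⟨cuspSymbol f γ, cuspSymbol_mem_periodLattice f γ⟩ := rfl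

variable [NeZero N]

/-- `u_ψ` is additive and kills the parabolic elements (Knapp Prop. 11.1). [cite: Knapp1993, Prop. 11.1] -/
theorem uψ_mem_parSp : uψ f ψ ∈ parSp N F := by
  refine ⟨fun γ δ => ?_, fun Q hQ => ?_⟩
  · funext i
    simp only [uψ_apply, Pi.add_apply]
    rw [← map_add]
    congr 1
    apply Subtype.ext
    show cuspSymbol f (γ * δ) = cuspSymbol f δ + cuspSymbol f γ
    rw [cuspSymbol_mul_holds f γ δ, add_comm]
  · obtain ⟨v, hv⟩ := hQ
    funext i
    simp only [uψ_apply, Pi.zero_apply]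
    have h0 : cuspSymbol f Q = 0 := cuspSymbol_eq_zero_of_isParabolic f (isParabolic_of_isEigenElt hv)
    have : (⟨cuspSymbol f Q, cuspSymbol_mem_periodLattice f Q⟩ : ↥(periodLattice f)) = 0 := Subtype.ext h0
    rw [this, map_zero]

/-- For a newform `f` (any degree): `a_p(f) · {∞, γ∞}_f = Σᵢ {∞, γ'ᵢ∞}_f ∈ Λ₀(f)` — `Λ₀(f)` is a module over the Hecke
order `ℤ[a_n(f)]`. [cite: Manin1972, Thm. 1.6] [cite: Shimura1971, (8.3.2)] -/
theorem coeff_mul_cuspSymbol_eq_sum (hf : IsNewform0 f) {p : ℕ} [NeZero p] (hp : p.Prime) (γ : Gamma0 N) :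
    cuspCoeff f p * cuspSymbol f γ = ∑ i : HeckeIdx N p, cuspSymbol f (heckePermElt hp γ i) := by
  rw [← cuspSymbol_heckeT_eq_sum hp f γ, hf.heckeT_eq_coeff_smul hp, cuspSymbol_smul]
  rfl

/-- `a_p · Λ₀(f) ⊆ Λ₀(f)` on cusp symbols of a newform (Hecke stability of the period lattice). [cite: Manin1972, Prop. 1.4 / Thm. 1.6] -/
theorem coeff_mul_cuspSymbol_mem (hf : IsNewform0 f) {p : ℕ} [NeZero p] (hp : p.Prime) (γ : Gamma0 N) :
    cuspCoeff f p * cuspSymbol f γ ∈ periodLattice f := by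
  rw [coeff_mul_cuspSymbol_eq_sum hf hp γ]
  exact AddSubgroup.sum_mem _ fun i _ => cuspSymbol_mem_periodLattice f _

/-- Hecke: if `ψ` is `a_p`-SEMILINEAR mod `ℓ` — `ψ(a_p x) = c · ψ(x)` — then `T_p u_ψ = c · u_ψ` (any degree `d`; for `d = 1`
this is automatic with `c = a_p mod ℓ`, tree `heckeU_functionalCocycle`). [cite: Shimura1971, §8.3 (8.3.2)] -/
theorem heckeU_uψ (hf : IsNewform0 f) {p : ℕ} [NeZero p] (hp : p.Prime) {c : F}
    (hψT : ∀ (x : ↥(periodLattice f)) (hx : cuspCoeff f p * (x : ℂ) ∈ periodLattice f),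
      ψ ⟨cuspCoeff f p * (x : ℂ), hx⟩ = c * ψ x) :
    heckeU 0 N F hp (uψ f ψ) = c • uψ f ψ := by
  funext γ i
  rw [heckeU_apply]
  simp only [act_zero_eq_id, LinearMap.id_apply, Finset.sum_apply, Pi.smul_apply, uψ_apply, smul_eq_mul]
  rw [← map_sum]
  have hsum : (∑ i : HeckeIdx N p, (⟨cuspSymbol f (heckePermElt hp γ i), cuspSymbol_mem_periodLattice f _⟩ :
      ↥(periodLattice f))) = ⟨cuspCoeff f p * cuspSymbol f γ, coeff_mul_cuspSymbol_mem hf hp γ⟩ := by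
    apply Subtype.ext
    rw [AddSubmonoidClass.coe_finsetSum]
    exact (coeff_mul_cuspSymbol_eq_sum hf hp γ).symm
  rw [hsum]
  exact hψT ⟨cuspSymbol f γ, cuspSymbol_mem_periodLattice f γ⟩ (coeff_mul_cuspSymbol_mem hf hp γ)

/-- `d = 1`: for the newform of an elliptic curve `a_p ∈ ℤ`, so every additive `ψ` is `a_p`-semilinear. [folklore] -/
theorem semilinear_of_isNewformOf {W : WeierstrassCurve ℚ} (hf : IsNewformOf W f) (p : ℕ)
    (x : ↥(periodLattice f)) (hx : cuspCoeff f p * (x : ℂ) ∈ periodLattice f) :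
    ψ ⟨cuspCoeff f p * (x : ℂ), hx⟩ = ((W.LFunction p : ℤ) : F) * ψ x := by
  have : (⟨cuspCoeff f p * (x : ℂ), hx⟩ : ↥(periodLattice f)) = (W.LFunction p : ℤ) • x := by
    apply Subtype.ext
    rw [AddSubgroupClass.coe_zsmul, zsmul_eq_mul]
    show cuspCoeff f p * (x : ℂ) = _
    rw [hf.2 p]
  rw [this, map_zsmul, zsmul_eq_mul]

/-- Atkin–Lehner: `w_Q f = e f` (`e = ±1` an integer) ⟹ `W_Q u_ψ = e u_ψ` (Manin's transport of periods under the
normaliser, tree `MultAL.cuspSymbol_eq_mul_of_conj_alW`). [cite: Manin1972, Prop. 1.4] [cite: Knapp1993, Lemma 9.24] -/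
theorem alOp_uψ (Q : ℕ) [NeZero Q] (hQN : Q ∣ N) (hc : Nat.Coprime Q (N / Q)) {e : ℤ}
    (hW : atkinLehnerInvolution N 2 Q f = ((e : ℤ) : ℂ) • f) :
    alOp F Q hQN hc (uψ f ψ) = ((e : ℤ) : F) • uψ f ψ := by
  funext γ i
  simp only [alOp_apply, uψ_apply, Pi.smul_apply, smul_eq_mul]
  have key : cuspSymbol f (alConj Q hQN hc γ) = (e : ℂ) * cuspSymbol f γ :=
    MultAL.cuspSymbol_eq_mul_of_conj_alW hQN hc hW γ (alConj Q hQN hc γ) (alConj_spec Q hQN hc γ)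
  have hsub : (⟨cuspSymbol f (alConj Q hQN hc γ), cuspSymbol_mem_periodLattice f _⟩ : ↥(periodLattice f)) =
      e • ⟨cuspSymbol f γ, cuspSymbol_mem_periodLattice f γ⟩ := by
    apply Subtype.ext
    show cuspSymbol f (alConj Q hQN hc γ) = ((e • ⟨cuspSymbol f γ, cuspSymbol_mem_periodLattice f γ⟩ : ↥(periodLattice f)) : ℂ)
    rw [key, AddSubgroupClass.coe_zsmul, zsmul_eq_mul]
  rw [hsub, map_zsmul, zsmul_eq_mul]

/-- Star: for `f` with real coefficients `{∞, JγJ∞}_f = conj {∞, γ∞}_f`. [cite: CremonaAlgorithms1997, §2.1.3] -/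
theorem cuspSymbol_starConj (hreal : ∀ n, (cuspCoeff f n).im = 0) (γ : Gamma0 N) :
    cuspSymbol f (starConj γ) = conj (cuspSymbol f γ) := by
  unfold cuspSymbol
  rw [starConj_apply_zero_zero, starConj_apply_one_zero]
  by_cases hc : (γ : SL(2, ℤ)) 1 0 = 0
  · rw [if_pos hc, if_pos (neg_eq_zero.mpr hc), map_zero]
  · rw [if_neg hc, if_neg (neg_eq_zero.not.mpr hc), ← modularSymbol_neg_eq_conj_holds f hreal, Int.cast_neg, div_neg]

/-- A star-even `ψ` on a real `f` gives a star-even `u_ψ`. [cite: Manin1972, §1.6] -/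
theorem starOp_uψ (hreal : ∀ n, (cuspCoeff f n).im = 0)
    (hψ : ∀ (x : ↥(periodLattice f)) (hx : conj (x : ℂ) ∈ periodLattice f), ψ ⟨conj (x : ℂ), hx⟩ = ψ x) :
    starOp F (uψ f ψ) = uψ f ψ := by
  funext γ i
  simp only [starOp_apply, uψ_apply]
  have hmem : conj (cuspSymbol f γ) ∈ periodLattice f := by
    rw [← cuspSymbol_starConj hreal γ]; exact cuspSymbol_mem_periodLattice f _
  have hsub : (⟨cuspSymbol f (starConj γ), cuspSymbol_mem_periodLattice f _⟩ : ↥(periodLattice f)) =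
      ⟨conj (cuspSymbol f γ), hmem⟩ := Subtype.ext (cuspSymbol_starConj hreal γ)
  rw [hsub]
  exact hψ ⟨cuspSymbol f γ, cuspSymbol_mem_periodLattice f γ⟩ hmem

/-- `u_ψ = 0` only if `ψ = 0` (`Λ₀(f)` is the range of the period homomorphism). [cite: Manin1972, Thm. 1.9] -/
theorem ψ_eq_zero_of_uψ_eq_zero (h : uψ f ψ = 0) : ψ = 0 := by
  ext x
  obtain ⟨x, hx⟩ := x
  have hx' : x ∈ (cuspSymbolHom f).range.toAddSubgroup := by rwa [← periodLattice_eq_toAddSubgroup_range]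
  obtain ⟨γ, hγ⟩ := MonoidHom.mem_range.mp hx'
  have hγ' : cuspSymbol f γ = x := hγ
  have hu := congrFun (congrFun h γ) 0
  simp only [uψ_apply, Pi.zero_apply] at hu
  have : (⟨x, hx⟩ : ↥(periodLattice f)) = ⟨cuspSymbol f γ, cuspSymbol_mem_periodLattice f γ⟩ := Subtype.ext hγ'.symm
  rw [this, hu, AddMonoidHom.zero_apply]

omit [NeZero N] in
/-- A non-zero additive `φ : Λ₀(f) → 𝔽_ℓ` killing `Λ₁(f)` makes `ℓ` divide the Shimura index `[Λ₀(f) : Λ₁(f)]`. [folklore] -/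
theorem dvd_relIndex_of_functional {ℓ : ℕ} [Fact ℓ.Prime] (φ : ↥(periodLattice f) →+ ZMod ℓ) (hφ0 : φ ≠ 0)
    (hvan : ∀ (x : ℂ) (hx : x ∈ periodLatticeGamma1 f), φ ⟨x, periodLatticeGamma1_le_periodLattice f hx⟩ = 0) :
    ℓ ∣ (periodLatticeGamma1 f).relIndex (periodLattice f) := by
  -- `φ` is onto `ℤ/ℓ`
  obtain ⟨x₀, hx₀⟩ : ∃ x₀, φ x₀ ≠ 0 := by
    by_contra h
    exact hφ0 (AddMonoidHom.ext fun x => by rw [AddMonoidHom.zero_apply]; exact not_not.mp (not_exists.mp h x))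
  have hsurj : Function.Surjective φ := fun y => by
    refine ⟨(y * (φ x₀)⁻¹).val • x₀, ?_⟩
    rw [map_nsmul, nsmul_eq_mul, ZMod.natCast_zmod_val, inv_mul_cancel_right₀ hx₀]
  -- `Λ₁ ∩ Λ₀ ≤ ker φ`, so `ℓ = #(Λ₀/ker φ)` divides `[Λ₀ : Λ₁]`
  have hle : (periodLatticeGamma1 f).addSubgroupOf (periodLattice f) ≤ φ.ker := by
    intro x hx
    rw [AddSubgroup.mem_addSubgroupOf] at hx
    rw [AddMonoidHom.mem_ker]
    have h := hvan (x : ℂ) hx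
    exact h
  have h1 : φ.ker.index ∣ ((periodLatticeGamma1 f).addSubgroupOf (periodLattice f)).index :=
    AddSubgroup.index_dvd_of_le hle
  have h2 : φ.ker.index = ℓ := by
    rw [AddSubgroup.index_ker, AddMonoidHom.range_eq_top.mpr hsurj, AddSubgroup.card_top, Nat.card_zmod]
  unfold AddSubgroup.relIndex
  rw [h2] at h1
  exact h1

end Functional

end Summit.BirchSwinnertonDyer.BirchSwinnertonDyer.Theorems.ManinLocalTwoThree.ShimuraSector

end
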